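import Literature.NumberTheory.GaloisCohomology.Howard2004.InertTransverseCountOfDiscrProofs
import HarnessLib

/-!
# Howard 2004, §1.2: a degree-two prime of a quadratic field lies over an INERT rational prime — the bridge from
# `IsDegreeTwo` (the currency of `SelmerTriple.primes`) to the hypotheses of Prop. 1.1.9's tree form (proofs file)

Topic `NumberTheory/GaloisCohomology/Howard2004` (sequel to `SelmerTriples` (`IsDegreeTwo`, `residueChar`,
`transverseStructure`), `KolyvaginPrimeOfFrobeniusProofs` (`isDegreeTwo_of_span_natCast_isPrime`, the converse)
and the Prop. 1.1.9 files `InertTameGeneratorRingClassProofs` … `InertTransverseCountOfDiscrProofs`, stated for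
«`(ℓ)` prime in `𝓞_K`, `λ ∋ ℓ`»).  THEOREMS ONLY: no definition, no named fact, no instance, no `sorry`.

B. Howard, *The Heegner point Kolyvagin system*, Compositio Math. 140 (2004), §1.2 (arXiv:1202.6340 p. 6
L57–58): «the set of degree two primes of `K`» — for `[K : ℚ] = 2` a prime `λ` with `#k_λ = ℓ²` (`ℓ = char k_λ`)
is `λ = ℓ𝓞_K` with `ℓ` INERT: `ℓ𝓞_K ⊆ λ` and both have index `ℓ²` (`N(ℓ𝓞_K) = ℓ^{[K:ℚ]}`).

* §1 `natCast_residueChar_mem_asIdeal`, `prime_residueChar`, `natCard_quot_span_natCast_eq_sq_of_finrank_eq_two`,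
  **`isPrime_span_residueChar_of_isDegreeTwo`** (`λ = ℓ𝓞_K`: tree `IsDegreeTwo.asIdeal_eq_span_residueChar`),
  `isDegreeTwo_iff_isPrime_span_residueChar`.
* §2 Prop. 1.1.9 and its counts in the `IsDegreeTwo` / `transverseStructure p ρ jbar (Sum.inr λ)` currency
  (`ℓ := residueChar λ`, `d_K < −4`, `(ℓ + 1)·T = 0`, trivial local action, `T` finite `p`-primary):
  **`isCompl_unramifiedSubgroup_transverseStructure_of_isDegreeTwo`**, `natCard_transverseStructure_eq_of_isDegreeTwo`,
  `natCard_transverseStructure_mul_eq_of_isDegreeTwo`, `exists_forall_pow_inv_mul_mem_localRingClassSubgroup_of_isDegreeTwo`,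
  `exists_transverse_submodule_isCompl_linearEquiv_of_isDegreeTwo`.
Cell `pub/bsd-print-x9`, G87 (print leaf `stub_h161` of stmt-BirchSwinnertonDyer-22642); seat `bsd-line-x9-p1-w3`
g14, brick (DEG2-INERT).  BSD is not proved by any of this.

References: [Howard2004HeegnerKolyvagin] §1.2, Prop. 1.1.9, Def. 1.2.2; [NeukirchANT1999] Ch. I §8; [GrossLMS1991] §3.
-/

set_option autoImplicit false

noncomputable section

open NumberField IsDedekindDomain IsDedekindDomain.HeightOneSpectrum Field

namespace Literature.NumberTheory.GaloisCohomology.Howard2004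

open Literature.NumberTheory.GaloisRepresentations
open Literature.NumberTheory.GaloisRepresentations.DiscreteGaloisModule
open Literature.NumberTheory.GaloisRepresentations.IsNonarchimedeanLocalField
open Literature.NumberTheory.EllipticCurves

variable {K : Type} [Field K] [NumberField K]

/-! ## §1 Degree-two primes of a quadratic field are the inert ones -/

omit [NumberField K] in
/-- The residue characteristic of `λ` lies in `λ`: `ℓ ∈ λ` for `ℓ = char(𝓞_K/λ)`.
[cite: Howard2004HeegnerKolyvagin, §1.2 (arXiv:1202.6340 p. 6 L57–58)] [cite: NeukirchANT1999, Ch. I §8] -/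
theorem natCast_residueChar_mem_asIdeal (v : HeightOneSpectrum (𝓞 K)) :
    ((residueChar v : ℕ) : 𝓞 K) ∈ v.asIdeal := by
  rw [← Ideal.Quotient.eq_zero_iff_mem, map_natCast]
  exact ringChar.Nat.cast_ringChar

/-- The residue characteristic of a nonzero prime `λ` of `𝓞_K` is a prime number (`𝓞_K/λ` is a finite field).
[cite: Howard2004HeegnerKolyvagin, §1.2 (arXiv:1202.6340 p. 6 L57–58)] [cite: NeukirchANT1999, Ch. I §8] -/
theorem prime_residueChar (v : HeightOneSpectrum (𝓞 K)) : (residueChar v).Prime := by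
  haveI : Finite (𝓞 K ⧸ v.asIdeal) := v.asIdeal.finiteQuotientOfFreeOfNeBot v.ne_bot
  letI : Field (𝓞 K ⧸ v.asIdeal) := Ideal.Quotient.field _
  unfold residueChar
  exact CharP.char_is_prime (𝓞 K ⧸ v.asIdeal) _

/-- **`#(𝓞_K/ℓ𝓞_K) = ℓ²` for a quadratic field** (`N(ℓ𝓞_K) = ℓ^{[K:ℚ]}`).
[cite: NeukirchANT1999, Ch. I §8 (fundamental identity `Σ e_i f_i = n`)] [cite: GrossLMS1991, §3 (PDF p. 216: «F_λ has ℓ² elements»)] -/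
theorem natCard_quot_span_natCast_eq_sq_of_finrank_eq_two (hK2 : Module.finrank ℚ K = 2) (ℓ : ℕ) :
    Nat.card (𝓞 K ⧸ Ideal.span {(ℓ : 𝓞 K)}) = ℓ ^ 2 := by
  rw [← Submodule.cardQuot_apply, ← Ideal.absNorm_apply, Ideal.absNorm_span_singleton,
    show (ℓ : 𝓞 K) = algebraMap ℤ (𝓞 K) (ℓ : ℤ) by simp, Algebra.norm_algebraMap,
    NumberField.RingOfIntegers.rank, hK2, Int.natAbs_pow, Int.natAbs_natCast]

/-- **`(ℓ)` is prime in `𝓞_K` at a degree-two prime of a quadratic field** (`ℓ = char k_λ` is INERT): for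
`[K : ℚ] = 2` and `#(𝓞_K/λ) = ℓ²`, `λ = ℓ𝓞_K` (`ℓ𝓞_K ⊆ λ`, both of index `ℓ²`; the equality itself is the tree's
`IsDegreeTwo.asIdeal_eq_span_residueChar` of `EllipticCurves/ZpExtensionKolyvaginPrimesShapiroEisensteinProofs`, re-derived
inline here to keep this file's imports inside `Howard2004`), hence `ℓ𝓞_K` is prime.
[cite: Howard2004HeegnerKolyvagin, §1.2 (arXiv:1202.6340 p. 6 L57–58: «degree two primes of K»)]
[cite: GrossLMS1991, §3 (PDF p. 216)] [cite: NeukirchANT1999, Ch. I §8] -/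
theorem isPrime_span_residueChar_of_isDegreeTwo (hK2 : Module.finrank ℚ K = 2) {v : HeightOneSpectrum (𝓞 K)}
    (hv : IsDegreeTwo v) : (Ideal.span {((residueChar v : ℕ) : 𝓞 K)}).IsPrime := by
  suffices heq : v.asIdeal = Ideal.span {((residueChar v : ℕ) : 𝓞 K)} by
    rw [← heq]; exact v.isPrime
  set ℓ : ℕ := residueChar v
  have hle : Ideal.span {((ℓ : ℕ) : 𝓞 K)} ≤ v.asIdeal :=
    (Ideal.span_singleton_le_iff_mem _).mpr (natCast_residueChar_mem_asIdeal v)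
  have hℓ : ℓ.Prime := prime_residueChar v
  haveI : Finite (𝓞 K ⧸ Ideal.span {((ℓ : ℕ) : 𝓞 K)}) :=
    Ideal.finiteQuotientOfFreeOfNeBot _ (by
      rw [Ne, Ideal.span_singleton_eq_bot]; exact_mod_cast hℓ.ne_zero)
  haveI : Finite (𝓞 K ⧸ v.asIdeal) := v.asIdeal.finiteQuotientOfFreeOfNeBot v.ne_bot
  -- the surjection `𝓞/ℓ → 𝓞/λ` between sets of the same size `ℓ²` is a bijection
  have hcard : Nat.card (𝓞 K ⧸ Ideal.span {((ℓ : ℕ) : 𝓞 K)}) = Nat.card (𝓞 K ⧸ v.asIdeal) := by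
    rw [natCard_quot_span_natCast_eq_sq_of_finrank_eq_two hK2]; exact hv.symm
  have hbij : Function.Bijective (Ideal.Quotient.factor hle) :=
    (Ideal.Quotient.factor_surjective hle).bijective_of_nat_card_le hcard.le
  refine le_antisymm (fun x hx => ?_) hle
  rw [← Ideal.Quotient.eq_zero_iff_mem]
  apply hbij.1
  rw [map_zero, Ideal.Quotient.factor_mk, Ideal.Quotient.eq_zero_iff_mem]
  exact hx

/-- **Degree two ⟺ inert** for a prime of a quadratic field (`ℓ = char k_λ`).
[cite: Howard2004HeegnerKolyvagin, §1.2 (arXiv:1202.6340 p. 6 L57–58)] [cite: NeukirchANT1999, Ch. I §8] -/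
theorem isDegreeTwo_iff_isPrime_span_residueChar (hK2 : Module.finrank ℚ K = 2) (v : HeightOneSpectrum (𝓞 K)) :
    IsDegreeTwo v ↔ (Ideal.span {((residueChar v : ℕ) : 𝓞 K)}).IsPrime :=
  ⟨isPrime_span_residueChar_of_isDegreeTwo hK2, fun h =>
    isDegreeTwo_of_span_natCast_isPrime hK2 (prime_residueChar v) h (natCast_residueChar_mem_asIdeal v)⟩

/-! ## §2 Prop. 1.1.9 in the `IsDegreeTwo` / `transverseStructure` currency -/

section Transverse

variable {M : Type} [AddCommGroup M] [TopologicalSpace M] [DiscreteTopology M]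

/-- **Howard Prop. 1.1.9 at a degree-two prime, `H¹(K_λ, T) = H¹_f ⊕ H¹_tr`**, for the component
`transverseStructure p T jbar (Sum.inr λ) = H¹_tr(K_λ, T)` of Howard's transverse structure: `K` imaginary quadratic
with `d_K < −4`, `λ` a degree-two prime with residue characteristic `ℓ`, `T` finite `p`-primary with trivial
`Γ_{K_λ}`-action and `(ℓ + 1)·T = 0`.
[cite: Howard2004HeegnerKolyvagin, Prop. 1.1.9 and Def. 1.2.2 (arXiv:1202.6340 p. 6 L17–25, L96–101)] -/
theorem isCompl_unramifiedSubgroup_transverseStructure_of_isDegreeTwo [Finite M] (p : ℕ) [Fact p.Prime]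
    (hK : IsImaginaryQuadratic K) (hd : NumberField.discr K < -4) (ρ : DiscreteGaloisModule K M)
    (jbar : AlgebraicClosure K →+* ℂ) {v : HeightOneSpectrum (𝓞 K)} (hv : IsDegreeTwo v)
    (htriv : ∀ (g : absoluteGaloisGroup (v.adicCompletion K)) (x : M), GaloisRep.toLocal v ρ g x = x)
    (hp : ∀ x : M, ∃ n : ℕ, p ^ n • x = 0) (hℓT : ∀ x : M, (residueChar v + 1) • x = 0) :
    IsCompl (DiscreteGaloisModule.unramifiedSubgroup (GaloisRep.toLocal v ρ) 1)
      (transverseStructure p ρ jbar (Sum.inr v)) :=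
  isCompl_unramifiedSubgroup_transverseCondition_of_discr_lt p hK hd ρ jbar (prime_residueChar v)
    (isPrime_span_residueChar_of_isDegreeTwo hK.1 hv) (natCast_residueChar_mem_asIdeal v) htriv hp hℓT

/-- **`#H¹_tr(K_λ, T) = #T`** at a degree-two prime (same hypotheses).
[cite: Howard2004HeegnerKolyvagin, Prop. 1.1.9 (arXiv:1202.6340 p. 6 L17–25)] -/
theorem natCard_transverseStructure_eq_of_isDegreeTwo [Finite M] (p : ℕ) [Fact p.Prime]
    (hK : IsImaginaryQuadratic K) (hd : NumberField.discr K < -4) (ρ : DiscreteGaloisModule K M)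
    (jbar : AlgebraicClosure K →+* ℂ) {v : HeightOneSpectrum (𝓞 K)} (hv : IsDegreeTwo v)
    (htriv : ∀ (g : absoluteGaloisGroup (v.adicCompletion K)) (x : M), GaloisRep.toLocal v ρ g x = x)
    (hp : ∀ x : M, ∃ n : ℕ, p ^ n • x = 0) (hℓT : ∀ x : M, (residueChar v + 1) • x = 0) :
    Nat.card (transverseStructure p ρ jbar (Sum.inr v)) = Nat.card M :=
  natCard_transverseCondition_eq_of_discr_lt p hK hd ρ jbar (prime_residueChar v)
    (isPrime_span_residueChar_of_isDegreeTwo hK.1 hv) (natCast_residueChar_mem_asIdeal v) htriv hp hℓT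

/-- **`#H¹_tr(K_λ, T) · #H¹_tr(K_λ', T) = #H¹(K_λ, T)`** for a degree-two prime `λ` and a prime `λ'` with the SAME
residue characteristic `ℓ` (e.g. `λ' = σλ = λ`), in the `ρ.toLocal (Sum.inr λ)` currency — the `hcard` of the isotropy-count
criterion for H.4 at `λ ∣ n` with `𝓣 = transverseStructure`.
[cite: Howard2004HeegnerKolyvagin, Prop. 1.1.9 and Lemma 1.5.6 (arXiv:1202.6340 p. 6 L17–25, p. 10 L86–88)] -/
theorem natCard_transverseStructure_mul_eq_of_isDegreeTwo [Finite M] (p : ℕ) [Fact p.Prime]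
    (hK : IsImaginaryQuadratic K) (hd : NumberField.discr K < -4) (ρ : DiscreteGaloisModule K M)
    (jbar : AlgebraicClosure K →+* ℂ) {v v' : HeightOneSpectrum (𝓞 K)} (hv : IsDegreeTwo v)
    (hchar : residueChar v' = residueChar v)
    (htriv : ∀ (g : absoluteGaloisGroup (v.adicCompletion K)) (x : M), GaloisRep.toLocal v ρ g x = x)
    (htriv' : ∀ (g : absoluteGaloisGroup (v'.adicCompletion K)) (x : M), GaloisRep.toLocal v' ρ g x = x)
    (hp : ∀ x : M, ∃ n : ℕ, p ^ n • x = 0) (hℓT : ∀ x : M, (residueChar v + 1) • x = 0) :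
    Nat.card (transverseStructure p ρ jbar (Sum.inr v)) * Nat.card (transverseStructure p ρ jbar (Sum.inr v')) =
      Nat.card (galoisCohomology (ρ.toLocal (Sum.inr v)) 1) := by
  have hv'mem : ((residueChar v : ℕ) : 𝓞 K) ∈ v'.asIdeal := hchar ▸ natCast_residueChar_mem_asIdeal v'
  have h := natCard_transverseCondition_mul_eq_of_discr_lt' p hK hd ρ jbar (prime_residueChar v)
    (isPrime_span_residueChar_of_isDegreeTwo hK.1 hv) (natCast_residueChar_mem_asIdeal v) hv'mem htriv htriv'
    hp hℓT
  change Nat.card (transverseCondition p ρ (residueChar v) jbar v) *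
      Nat.card (transverseCondition p ρ (residueChar v') jbar v') = _
  rw [hchar]
  exact h

/-- **`hcyc` at a degree-two prime** (`d_K < −4`): some `σ₀ ∈ I_{K_λ}` with
`Γ_{K_λ} = ⋃_j σ₀^j (Γ_{K_λ} ∩ Γ_{K[ℓ]})`, `ℓ = char k_λ`.
[cite: Howard2004HeegnerKolyvagin, §1.2 (arXiv:1202.6340 p. 6 L84–95)] [cite: GrossLMS1991, §3 (PDF p. 217 l. 1–3)] -/
theorem exists_forall_pow_inv_mul_mem_localRingClassSubgroup_of_isDegreeTwo (hK : IsImaginaryQuadratic K)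
    (hd : NumberField.discr K < -4) (jbar : AlgebraicClosure K →+* ℂ) {v : HeightOneSpectrum (𝓞 K)}
    (hv : IsDegreeTwo v) :
    ∃ σ₀ : absoluteGaloisGroup (v.adicCompletion K), σ₀ ∈ absInertia (v.adicCompletion K) ∧
      ∀ σ : absoluteGaloisGroup (v.adicCompletion K), ∃ j : ℕ,
        (σ₀ ^ j)⁻¹ * σ ∈ localRingClassSubgroup (residueChar v) jbar v :=
  exists_forall_pow_inv_mul_mem_localRingClassSubgroup_of_discr_lt hK hd jbar (prime_residueChar v)
    (isPrime_span_residueChar_of_isDegreeTwo hK.1 hv) (natCast_residueChar_mem_asIdeal v)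

/-- **Prop. 1.1.9 `R`-linearly at a degree-two prime**: an `R`-submodule `V_tr` of `H¹(K_λ, T)` (`moduleH1`) with
underlying subgroup `transverseStructure p T jbar (Sum.inr λ)`, complementary to `H¹_f`, and `H¹_f ≃ₗ[R] T`,
`V_tr ≃ₗ[R] T` — the inputs `hc` / `ef` / `etr` of the Lagrangian transfer (Prop. 1.5.9) at `λ ∣ n`.
[cite: Howard2004HeegnerKolyvagin, Prop. 1.1.9, §1.5 (arXiv:1202.6340 p. 6 L17–25, p. 9 L105–108)] -/
theorem exists_transverse_submodule_isCompl_linearEquiv_of_isDegreeTwo [Finite M] {R : Type} [CommRing R]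
    [Module R M] (p : ℕ) [Fact p.Prime] (hK : IsImaginaryQuadratic K) (hd : NumberField.discr K < -4)
    (ρ : DiscreteGaloisModule K M) (jbar : AlgebraicClosure K →+* ℂ) {v : HeightOneSpectrum (𝓞 K)}
    (hv : IsDegreeTwo v) (hρv : DiscreteGaloisModule.IsScalarLinear R (GaloisRep.toLocal v ρ))
    (htriv : ∀ (g : absoluteGaloisGroup (v.adicCompletion K)) (x : M), GaloisRep.toLocal v ρ g x = x)
    (hp : ∀ x : M, ∃ n : ℕ, p ^ n • x = 0) (hℓT : ∀ x : M, (residueChar v + 1) • x = 0) :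
    letI := galoisCohomology.moduleH1 (GaloisRep.toLocal v ρ) hρv
    ∃ Vtr : Submodule R (galoisCohomology (GaloisRep.toLocal v ρ) 1),
      Vtr.toAddSubgroup = transverseStructure p ρ jbar (Sum.inr v) ∧
      IsCompl (DiscreteGaloisModule.unramifiedSubmodule hρv) Vtr ∧
      Nonempty (↥(DiscreteGaloisModule.unramifiedSubmodule hρv) ≃ₗ[R] M) ∧
      Nonempty (↥Vtr ≃ₗ[R] M) :=
  exists_transverse_submodule_isCompl_linearEquiv_of_discr_lt p hK hd ρ jbar (prime_residueChar v)
    (isPrime_span_residueChar_of_isDegreeTwo hK.1 hv) (natCast_residueChar_mem_asIdeal v) hρv htriv hp hℓT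

end Transverse

end Literature.NumberTheory.GaloisCohomology.Howard2004

end
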